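import Summits.CriticalPhenomena.PercolationContinuityZ3.Theorems.PercNearOneGluingNoHeavyQuantFiveDisplays
import HarnessLib

/-!
# QUANT lane / PAPER-2 rate track (ARM-2 = constants bookkeeper, gen 5): the Peierls constant `2⁻⁵` in the dimensions `d = 7, 8, 9, 10` —
# orbit defects `η(2⁻⁵, d)` to the last binary digit and the numeral displays `π_{p_c(ℤ^d)}(N) ≤ (1 − 2^{−a_d})^⌊(log*₂ N − 6)/2⌋`,
# `a₇ = 89216`, `a₈ = 205313`, `a₉ = 464755`, `a₁₀ = 1038420`

builds on p205010 (kernel theorem, internal audit signed; external expert review pending)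

Cell `prim-quant`, seat `prim-quant-arm-2` (`run/shared/lean/prim/quant/prim-quant-arm-2/RATE-CONSTANTS.md` §2g).  Completes the `2⁻⁵` table of
`…QuantFiveDisplays` (`d = 3..6` sharp, `a_d = 2294, 6199, 15666, 37940`, and every `3 ≤ d ≤ 32` in closed form) over the remaining dimensions
of the numeral table (`…QuantSixDisplaysMidD` p250578 had `94896, 218296, 493968, 1103338` at `2⁻⁶`; `…QuantPkOrbitMidD` p249293 at `2⁻⁸`):

* orbit defects (generic cast form `EpsSharp.epsOrbitDefect_half_pow_castForm` at `K(2⁻⁵) = 5679`, two kernel-decided integer comparisons each; interval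
  values `89215.08`, `205312.21`, `464754.20`, `1038419.26`): `orbit_five_seven/eight/nine/ten_sharp`;
* displays (`fiveScaleDefect_criticalProbI_orbit` + bridge `epsLHi_le_knLHi` p249770 + `knShiftC_eq_six_of_le32` p249070 through the schema p246289):
  `oneArm_rate_Z7..Z10_five_sharp`, with the two-sided `θ` forms (`8d² = 392, 512, 648, 800`).

An explicit function tending to `0` and nothing more (iterated-logarithm type); the Galton–Watson count moves the BASE only; class unchanged; honest
sentence unchanged.  No definitions, no sorries; standard axioms.  [cite: KozmaNitzan2024, §4 Theorem 6 (pp. 25–31)] [cite: DuminilcopinKozmaTassion2020, Proposition 1]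
-/

noncomputable section

namespace Summit.CriticalPhenomena.PercolationContinuityZ3.Theorems.Quant.EpsSharp

open MeasureTheory Literature.Probability.Percolation Literature.Probability.LatticeModels

/-! ## Orbit defects `η(2⁻⁵, d)`, `d = 7, 8, 9, 10`, to the last binary digit -/

/-- **`d = 7`, `a = 5`: `(1/2)^89216 < η(2⁻⁵, 7) < (1/2)^89215`** (interval value `log₂(1/η) = 89215.08`; at `2⁻⁶`: `94895.44`). [folklore] (numeric) -/
theorem orbit_five_seven_sharp :
    (1 / 2 : ℝ) ^ 89216 < epsOrbitDefect ((1 / 2 : ℝ) ^ 5) 7 ∧ epsOrbitDefect ((1 / 2 : ℝ) ^ 5) 7 < (1 / 2 : ℝ) ^ 89215 := by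
  rw [epsOrbitDefect_half_pow_castForm (by norm_num) 5]
  exact one_div_sandwich_of_nat (A := 2 ^ (7 * 2 ^ 7)) (C := 2 ^ (2 * 5) * ((96 * (7 + 1)) ^ 2 * 200)) (Klo := 5679) (Khi := 5679)
    (K := epsK ((1 / 2 : ℝ) ^ 5)) (n := 2 * (7 * 2 ^ 7)) (a := 89215) (by positivity) (by positivity) (by norm_num)
    epsK_five_eq.ge epsK_five_eq.le (by decide +kernel) (by decide +kernel)

/-- **`d = 8`, `a = 5`: `(1/2)^205313 < η(2⁻⁵, 8) < (1/2)^205312`** (interval value `205312.21`; at `2⁻⁶`: `218295.88`). [folklore] (numeric) -/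
theorem orbit_five_eight_sharp :
    (1 / 2 : ℝ) ^ 205313 < epsOrbitDefect ((1 / 2 : ℝ) ^ 5) 8 ∧ epsOrbitDefect ((1 / 2 : ℝ) ^ 5) 8 < (1 / 2 : ℝ) ^ 205312 := by
  rw [epsOrbitDefect_half_pow_castForm (by norm_num) 5]
  exact one_div_sandwich_of_nat (A := 2 ^ (8 * 2 ^ 8)) (C := 2 ^ (2 * 5) * ((96 * (8 + 1)) ^ 2 * 200)) (Klo := 5679) (Khi := 5679)
    (K := epsK ((1 / 2 : ℝ) ^ 5)) (n := 2 * (8 * 2 ^ 8)) (a := 205312) (by positivity) (by positivity) (by norm_num)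
    epsK_five_eq.ge epsK_five_eq.le (by decide +kernel) (by decide +kernel)

/-- **`d = 9`, `a = 5`: `(1/2)^464755 < η(2⁻⁵, 9) < (1/2)^464754`** (interval value `464754.20`; at `2⁻⁶`: `493967.45`). [folklore] (numeric) -/
theorem orbit_five_nine_sharp :
    (1 / 2 : ℝ) ^ 464755 < epsOrbitDefect ((1 / 2 : ℝ) ^ 5) 9 ∧ epsOrbitDefect ((1 / 2 : ℝ) ^ 5) 9 < (1 / 2 : ℝ) ^ 464754 := by
  rw [epsOrbitDefect_half_pow_castForm (by norm_num) 5]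
  exact one_div_sandwich_of_nat (A := 2 ^ (9 * 2 ^ 9)) (C := 2 ^ (2 * 5) * ((96 * (9 + 1)) ^ 2 * 200)) (Klo := 5679) (Khi := 5679)
    (K := epsK ((1 / 2 : ℝ) ^ 5)) (n := 2 * (9 * 2 ^ 9)) (a := 464754) (by positivity) (by positivity) (by norm_num)
    epsK_five_eq.ge epsK_five_eq.le (by decide +kernel) (by decide +kernel)

/-- **`d = 10`, `a = 5`: `(1/2)^1038420 < η(2⁻⁵, 10) < (1/2)^1038419`** (interval value `1038419.26`; at `2⁻⁶`: `1103337.59`). [folklore] (numeric) -/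
theorem orbit_five_ten_sharp :
    (1 / 2 : ℝ) ^ 1038420 < epsOrbitDefect ((1 / 2 : ℝ) ^ 5) 10 ∧ epsOrbitDefect ((1 / 2 : ℝ) ^ 5) 10 < (1 / 2 : ℝ) ^ 1038419 := by
  rw [epsOrbitDefect_half_pow_castForm (by norm_num) 5]
  exact one_div_sandwich_of_nat (A := 2 ^ (10 * 2 ^ 10)) (C := 2 ^ (2 * 5) * ((96 * (10 + 1)) ^ 2 * 200)) (Klo := 5679) (Khi := 5679)
    (K := epsK ((1 / 2 : ℝ) ^ 5)) (n := 2 * (10 * 2 ^ 10)) (a := 1038419) (by positivity) (by positivity) (by norm_num)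
    epsK_five_eq.ge epsK_five_eq.le (by decide +kernel) (by decide +kernel)

/-! ## Displays `d = 7, 8, 9, 10` at the Peierls constant `2⁻⁵` -/

/-- **`ℤ⁷` at `2⁻⁵`**: `π_{p_c(ℤ⁷)}(N) ≤ (1 − 2⁻⁸⁹²¹⁶)^⌊(log*₂ N − 6)/2⌋` (at `2⁻⁶`: `2⁻⁹⁴⁸⁹⁶`, p250578).  An explicit function tending to `0` and nothing more.
builds on p205010 (kernel theorem, internal audit signed; external expert review pending). [cite: KozmaNitzan2024, §4 Theorem 6] -/
theorem oneArm_rate_Z7_five_sharp (N : ℕ) :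
    oneArmProb 7 (criticalProbI 7) N ≤ (1 - (1 / 2 : ℝ) ^ 89216) ^ ((logStar 2 N - 6) / 2) :=
  PkSharp.oneArm_le_base_pow_of_scaleDefect (by norm_num) (fiveScaleDefect_criticalProbI_orbit (d := 7) (by norm_num)) (fun m => le_epsLHi _ 7 m)
    (fun m => epsLHi_le_knLHi (d := 7) (by norm_num) knEps_le_half_pow_five (by norm_num) m) (by positivity) orbit_five_seven_sharp.1.le
    (epsOrbitDefect_half_pow_le_one (by norm_num) 5) (knShiftC_eq_six_of_le32 (d := 7) (by norm_num) (by norm_num)).le N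

/-- **`ℤ⁷` at `2⁻⁵`, `θ` two-sided**: `p − p_c ≤ θ(p) ≤ 2(1 − 2⁻⁸⁹²¹⁶)^⌊(log*₂ n − 6)/2⌋ + 392(2n+1)⁷(p − p_c)²` on `[p_c, p_c + 1/4]`.
builds on p205010 (kernel theorem, internal audit signed; external expert review pending). [cite: DuminilCopinTassionEM2016, Thm. 1.1(2)] -/
theorem theta_two_sided_Z7_five_sharp (p : unitInterval) (hpc : (criticalProbI 7 : ℝ) ≤ p) (hp : (p : ℝ) ≤ criticalProbI 7 + 1 / 4) (n : ℕ) :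
    (p : ℝ) - criticalProbI 7 ≤ theta (zdGraph 7) 0 p ∧
      theta (zdGraph 7) 0 p ≤ 2 * (1 - (1 / 2 : ℝ) ^ 89216) ^ ((logStar 2 n - 6) / 2) +
        392 * (2 * n + 1 : ℝ) ^ 7 * ((p : ℝ) - criticalProbI 7) ^ 2 := by
  obtain ⟨hlo, hhi⟩ := PkSharp.theta_two_sided_of_scaleDefect (d := 7) (by norm_num) (fiveScaleDefect_criticalProbI_orbit (d := 7) (by norm_num))
    (fun m => le_epsLHi _ 7 m) (fun m => epsLHi_le_knLHi (d := 7) (by norm_num) knEps_le_half_pow_five (by norm_num) m) (by positivity)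
    orbit_five_seven_sharp.1.le (epsOrbitDefect_half_pow_le_one (by norm_num) 5) (knShiftC_eq_six_of_le32 (d := 7) (by norm_num) (by norm_num)).le p hpc hp n
  refine ⟨hlo, ?_⟩
  have e : (8 : ℝ) * ((7 : ℕ) : ℝ) ^ 2 = 392 := by norm_num
  rw [e] at hhi
  exact hhi

/-- **`ℤ⁸` at `2⁻⁵`**: `π_{p_c(ℤ⁸)}(N) ≤ (1 − 2⁻²⁰⁵³¹³)^⌊(log*₂ N − 6)/2⌋` (at `2⁻⁶`: `2⁻²¹⁸²⁹⁶`).  An explicit function tending to `0` and nothing more.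
builds on p205010 (kernel theorem, internal audit signed; external expert review pending). [cite: KozmaNitzan2024, §4 Theorem 6] -/
theorem oneArm_rate_Z8_five_sharp (N : ℕ) :
    oneArmProb 8 (criticalProbI 8) N ≤ (1 - (1 / 2 : ℝ) ^ 205313) ^ ((logStar 2 N - 6) / 2) :=
  PkSharp.oneArm_le_base_pow_of_scaleDefect (by norm_num) (fiveScaleDefect_criticalProbI_orbit (d := 8) (by norm_num)) (fun m => le_epsLHi _ 8 m)
    (fun m => epsLHi_le_knLHi (d := 8) (by norm_num) knEps_le_half_pow_five (by norm_num) m) (by positivity) orbit_five_eight_sharp.1.le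
    (epsOrbitDefect_half_pow_le_one (by norm_num) 5) (knShiftC_eq_six_of_le32 (d := 8) (by norm_num) (by norm_num)).le N

/-- **`ℤ⁸` at `2⁻⁵`, `θ` two-sided**: `p − p_c ≤ θ(p) ≤ 2(1 − 2⁻²⁰⁵³¹³)^⌊(log*₂ n − 6)/2⌋ + 512(2n+1)⁸(p − p_c)²` on `[p_c, p_c + 1/4]`.
builds on p205010 (kernel theorem, internal audit signed; external expert review pending). [cite: DuminilCopinTassionEM2016, Thm. 1.1(2)] -/
theorem theta_two_sided_Z8_five_sharp (p : unitInterval) (hpc : (criticalProbI 8 : ℝ) ≤ p) (hp : (p : ℝ) ≤ criticalProbI 8 + 1 / 4) (n : ℕ) :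
    (p : ℝ) - criticalProbI 8 ≤ theta (zdGraph 8) 0 p ∧
      theta (zdGraph 8) 0 p ≤ 2 * (1 - (1 / 2 : ℝ) ^ 205313) ^ ((logStar 2 n - 6) / 2) +
        512 * (2 * n + 1 : ℝ) ^ 8 * ((p : ℝ) - criticalProbI 8) ^ 2 := by
  obtain ⟨hlo, hhi⟩ := PkSharp.theta_two_sided_of_scaleDefect (d := 8) (by norm_num) (fiveScaleDefect_criticalProbI_orbit (d := 8) (by norm_num))
    (fun m => le_epsLHi _ 8 m) (fun m => epsLHi_le_knLHi (d := 8) (by norm_num) knEps_le_half_pow_five (by norm_num) m) (by positivity)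
    orbit_five_eight_sharp.1.le (epsOrbitDefect_half_pow_le_one (by norm_num) 5) (knShiftC_eq_six_of_le32 (d := 8) (by norm_num) (by norm_num)).le p hpc hp n
  refine ⟨hlo, ?_⟩
  have e : (8 : ℝ) * ((8 : ℕ) : ℝ) ^ 2 = 512 := by norm_num
  rw [e] at hhi
  exact hhi

/-- **`ℤ⁹` at `2⁻⁵`**: `π_{p_c(ℤ⁹)}(N) ≤ (1 − 2⁻⁴⁶⁴⁷⁵⁵)^⌊(log*₂ N − 6)/2⌋` (at `2⁻⁶`: `2⁻⁴⁹³⁹⁶⁸`).  An explicit function tending to `0` and nothing more.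
builds on p205010 (kernel theorem, internal audit signed; external expert review pending). [cite: KozmaNitzan2024, §4 Theorem 6] -/
theorem oneArm_rate_Z9_five_sharp (N : ℕ) :
    oneArmProb 9 (criticalProbI 9) N ≤ (1 - (1 / 2 : ℝ) ^ 464755) ^ ((logStar 2 N - 6) / 2) :=
  PkSharp.oneArm_le_base_pow_of_scaleDefect (by norm_num) (fiveScaleDefect_criticalProbI_orbit (d := 9) (by norm_num)) (fun m => le_epsLHi _ 9 m)
    (fun m => epsLHi_le_knLHi (d := 9) (by norm_num) knEps_le_half_pow_five (by norm_num) m) (by positivity) orbit_five_nine_sharp.1.le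
    (epsOrbitDefect_half_pow_le_one (by norm_num) 5) (knShiftC_eq_six_of_le32 (d := 9) (by norm_num) (by norm_num)).le N

/-- **`ℤ⁹` at `2⁻⁵`, `θ` two-sided**: `p − p_c ≤ θ(p) ≤ 2(1 − 2⁻⁴⁶⁴⁷⁵⁵)^⌊(log*₂ n − 6)/2⌋ + 648(2n+1)⁹(p − p_c)²` on `[p_c, p_c + 1/4]`.
builds on p205010 (kernel theorem, internal audit signed; external expert review pending). [cite: DuminilCopinTassionEM2016, Thm. 1.1(2)] -/
theorem theta_two_sided_Z9_five_sharp (p : unitInterval) (hpc : (criticalProbI 9 : ℝ) ≤ p) (hp : (p : ℝ) ≤ criticalProbI 9 + 1 / 4) (n : ℕ) :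
    (p : ℝ) - criticalProbI 9 ≤ theta (zdGraph 9) 0 p ∧
      theta (zdGraph 9) 0 p ≤ 2 * (1 - (1 / 2 : ℝ) ^ 464755) ^ ((logStar 2 n - 6) / 2) +
        648 * (2 * n + 1 : ℝ) ^ 9 * ((p : ℝ) - criticalProbI 9) ^ 2 := by
  obtain ⟨hlo, hhi⟩ := PkSharp.theta_two_sided_of_scaleDefect (d := 9) (by norm_num) (fiveScaleDefect_criticalProbI_orbit (d := 9) (by norm_num))
    (fun m => le_epsLHi _ 9 m) (fun m => epsLHi_le_knLHi (d := 9) (by norm_num) knEps_le_half_pow_five (by norm_num) m) (by positivity)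
    orbit_five_nine_sharp.1.le (epsOrbitDefect_half_pow_le_one (by norm_num) 5) (knShiftC_eq_six_of_le32 (d := 9) (by norm_num) (by norm_num)).le p hpc hp n
  refine ⟨hlo, ?_⟩
  have e : (8 : ℝ) * ((9 : ℕ) : ℝ) ^ 2 = 648 := by norm_num
  rw [e] at hhi
  exact hhi

/-- **`ℤ¹⁰` at `2⁻⁵`**: `π_{p_c(ℤ¹⁰)}(N) ≤ (1 − 2⁻¹⁰³⁸⁴²⁰)^⌊(log*₂ N − 6)/2⌋` (at `2⁻⁶`: `2⁻¹¹⁰³³³⁸`).  An explicit function tending to `0` and nothing more.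
builds on p205010 (kernel theorem, internal audit signed; external expert review pending). [cite: KozmaNitzan2024, §4 Theorem 6] -/
theorem oneArm_rate_Z10_five_sharp (N : ℕ) :
    oneArmProb 10 (criticalProbI 10) N ≤ (1 - (1 / 2 : ℝ) ^ 1038420) ^ ((logStar 2 N - 6) / 2) :=
  PkSharp.oneArm_le_base_pow_of_scaleDefect (by norm_num) (fiveScaleDefect_criticalProbI_orbit (d := 10) (by norm_num)) (fun m => le_epsLHi _ 10 m)
    (fun m => epsLHi_le_knLHi (d := 10) (by norm_num) knEps_le_half_pow_five (by norm_num) m) (by positivity) orbit_five_ten_sharp.1.le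
    (epsOrbitDefect_half_pow_le_one (by norm_num) 5) (knShiftC_eq_six_of_le32 (d := 10) (by norm_num) (by norm_num)).le N

/-- **`ℤ¹⁰` at `2⁻⁵`, `θ` two-sided**: `p − p_c ≤ θ(p) ≤ 2(1 − 2⁻¹⁰³⁸⁴²⁰)^⌊(log*₂ n − 6)/2⌋ + 800(2n+1)¹⁰(p − p_c)²` on `[p_c, p_c + 1/4]`.
builds on p205010 (kernel theorem, internal audit signed; external expert review pending). [cite: DuminilCopinTassionEM2016, Thm. 1.1(2)] -/
theorem theta_two_sided_Z10_five_sharp (p : unitInterval) (hpc : (criticalProbI 10 : ℝ) ≤ p) (hp : (p : ℝ) ≤ criticalProbI 10 + 1 / 4) (n : ℕ) :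
    (p : ℝ) - criticalProbI 10 ≤ theta (zdGraph 10) 0 p ∧
      theta (zdGraph 10) 0 p ≤ 2 * (1 - (1 / 2 : ℝ) ^ 1038420) ^ ((logStar 2 n - 6) / 2) +
        800 * (2 * n + 1 : ℝ) ^ 10 * ((p : ℝ) - criticalProbI 10) ^ 2 := by
  obtain ⟨hlo, hhi⟩ := PkSharp.theta_two_sided_of_scaleDefect (d := 10) (by norm_num) (fiveScaleDefect_criticalProbI_orbit (d := 10) (by norm_num))
    (fun m => le_epsLHi _ 10 m) (fun m => epsLHi_le_knLHi (d := 10) (by norm_num) knEps_le_half_pow_five (by norm_num) m) (by positivity)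
    orbit_five_ten_sharp.1.le (epsOrbitDefect_half_pow_le_one (by norm_num) 5) (knShiftC_eq_six_of_le32 (d := 10) (by norm_num) (by norm_num)).le p hpc hp n
  refine ⟨hlo, ?_⟩
  have e : (8 : ℝ) * ((10 : ℕ) : ℝ) ^ 2 = 800 := by norm_num
  rw [e] at hhi
  exact hhi

end Summit.CriticalPhenomena.PercolationContinuityZ3.Theorems.Quant.EpsSharp


namespace Summit.CriticalPhenomena.PercolationContinuityZ3.Theorems.Quant.EpsSharp

open Literature.Probability.Percolation

variable {d : ℕ}

/-! ## The two-sided closed form at `2⁻⁵`, every `d ≥ 1` -/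

/-- **Closed-form MAJORANT of the orbit defect at `2⁻⁵`, every `d ≥ 1`**: `η(2⁻⁵, d) ≤ ((1/2)^86/(d+1)^4)^{d·2^d}` (p247160's upper bracket at `a = 5`,
`τ_U(2⁻⁵,d) ≤ 2⁻⁸⁰/(64(d+1)⁴)`).  With `fiveOrbitDefect_ge_closedForm` (`…QuantFiveDisplays`): `log₂(1/η_d(2⁻⁵)) = d·2^d·(c₅ + 4 log₂(d+1))`, `86 ≤ c₅ ≤ 89`
(exact `c₅ = 87.57…`; `c₆ ∈ [93, 96]` at `2⁻⁶`, `c₈ = 106.49` at `2⁻⁸`). [folklore] -/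
theorem fiveOrbitDefect_le_closedForm (hd1 : 1 ≤ d) :
    epsTauU ((1 / 2 : ℝ) ^ 5) d ^ (d * 2 ^ d) ≤ ((1 / 2 : ℝ) ^ 86 / ((d : ℝ) + 1) ^ 4) ^ (d * 2 ^ d) := by
  have h := epsTauU_half_pow_le hd1 5
  refine pow_le_pow_left₀ (epsTauU_pos hd1 (by positivity)).le (h.trans (le_of_eq ?_)) _
  have hD : (0 : ℝ) < ((d : ℝ) + 1) ^ 4 := by positivity
  rw [div_eq_div_iff (by positivity) (ne_of_gt hD)]
  push_cast
  ring

/-- **The orbit defect at `2⁻⁵` in closed form, two-sided, every `d ≥ 1`**: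
`((1/2)^89/(d+1)^4)^{d·2^d} ≤ η(2⁻⁵, d) ≤ ((1/2)^86/(d+1)^4)^{d·2^d}`. [folklore] -/
theorem fiveOrbitDefect_closedForm_two_sided (hd1 : 1 ≤ d) :
    ((1 / 2 : ℝ) ^ 89 / ((d : ℝ) + 1) ^ 4) ^ (d * 2 ^ d) ≤ epsTauU ((1 / 2 : ℝ) ^ 5) d ^ (d * 2 ^ d) ∧
      epsTauU ((1 / 2 : ℝ) ^ 5) d ^ (d * 2 ^ d) ≤ ((1 / 2 : ℝ) ^ 86 / ((d : ℝ) + 1) ^ 4) ^ (d * 2 ^ d) :=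
  ⟨fiveOrbitDefect_ge_closedForm hd1, fiveOrbitDefect_le_closedForm hd1⟩

end Summit.CriticalPhenomena.PercolationContinuityZ3.Theorems.Quant.EpsSharp

end
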